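import Literature.MathematicalPhysics.QuantumFieldTheory.Balaban1983to89.Node00.N24ItemsStage13AtThm1CCMWOfStepRSignFreeAllTorusSepCoPH
import Literature.MathematicalPhysics.QuantumFieldTheory.Balaban1983to89.Node00.Record13NumericsOfThm1CCMZ
import Literature.MathematicalPhysics.QuantumFieldTheory.Balaban1983to89.Node00.Record12BgRowCoClassGaugeRGuardedBRow

/-!
# NODE N24 · THE FOUR DOOR ROWS AT THE z-WITNESS `θ₁₅ᶜᶜᴹᵂᶻ(j; γ; Efl, logz) = theta13OfThm1CCMWZ F N j γ ε₀ ε₂₉ B₃ B₃' a₀ a₁ Efl logz` (DEF-1's FLAG-№9 edition, `Record13NumericsOfThm1CCMZ`):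
# `Provisos₁₃SepCoPH` (the door, sign-free road), `Admissible`, `ZhUnity ∧ SlotsNondegenerate₁₃`, and N13's (R₁₃) law chain — the inputs `hP hθ hU hlaws` of the door-free closers
# `Summits/…/BalabanUVNodesN24LineTwoRung1AtAbstractWitnessOfChildrenSlotLetter` (p639124), so that their instantiation at the z-witness is ONE `exact`

STAGE-2 RE-KEY (dag-n24-c g20; S2-campaign row 10 by director-ym №346 (2) ∕ №356 ∕ №365 (1), one level above node00-def-T's chain B ×4 in-place re-keys of
`Record13SepCoPInhabitedOfThm1CCM{GaugeR, WGaugeR, WGaugeRSignFree, WGaugeRAllTorus}` — this file's chain import: `N24ItemsStage13AtThm1CCMWOfStepRSignFreeAllTorusSepCoPH` (Part 14, itself re-keyed in this row, over chain B4 `Record13SepCoPInhabitedOfThm1CCMWGaugeRAllTorus`)): (E1) Stage-2 coherence re-key to print's (2.3) datum;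
the (b)-keyed text survives in git history.  Every displayed (8) ∕ (9) ∕ step token of this file is now the GUARDED `(bd, Dat)` ᴮ token at the floor guard `floorGuard F c` (`c ≤ ν.M₁`), print's bond
datum `lamDatum F` ([14] (2.3): `lamBondsSeq Ω k`) and the (7)-data predicate of record `dataSmall7PTopOf F N`: (8) `VariationalThm1RegSepCoP7MGB F N (floorGuard F c) (lamDatum F) (dataSmall7PTopOf F N)
B₃ a₀ a₁` (`Record12BgRowCoClassCPMFloorB`), (9) `VariationalThm1GaugeRegSepCoP7MGB F N (F.L ^ j) (floorGuard F c) (lamDatum F) (dataSmall7PTopOf F N) B₃ B₃' a₀ a₁` (`Record12BgRowCoClassGaugeRGuardedB`; from the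
step token by `variationalThm1GaugeRegSepCoP7MGB_of_gauge9TopStepGB`), step `Gauge9RegSepTopStepGB F N suppDom (F.L ^ j) (floorGuard F c) (lamDatum F) (dataSmall7PTopOf F N) B₃ B₃' a₀ a₁`
(`TorusCoverGaugeTokensGuardedB`).  Declaration NAMES, binder names and binder ORDER are unchanged (the `R` ∕ `7M` in them is historical); the prose «(8) ∕ the (9)-line-1 gauge sentence ∕ the R (9)-step
fact» below denotes these ᴮ tokens; proofs are unchanged except the supplier name `variationalThm1GaugeRegSepCoP7MGB_of_gauge9TopStepGB`.  Re-keying bookkeeping only — nothing of Bałaban asserted.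
[14] = [Balaban1984PropagatorsII].

TRACK A (YM-PLAN §2d, node N24 = binder B2, composite), seat `pub-ymgap-dag-n24-c` (R134 s2; gen 12, Part 43); Literature∕Node00 lane `--supports stmt-QuantumFields-27364`; count-neutral.
CONTEXT (director-ym №218 FLAG №9; DEF-1 g9 Z1 p637981 ∕ Z2 p639492).  K0a's door witness `θ₁₅ᶜᶜᴹᵂ` is COUPLING-BLIND (`Efl = logz := 0`), and dag-n13-w3's p637054 makes K1⁹'s body false
there; the Z edition threads the two letters `(Efl, logz)` through the makers — `theta13OfThm1CCMW … = theta13OfThm1CCMWZ … 0 0` by `rfl` — and №9 (4) asks for ONE door-keyed closer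
re-keyed at the z-witness.  The N24 closers are door-free since p639124; what they consume at a witness `θ` are its four DOOR ROWS.  THIS FILE supplies them at `θ := ofHistoryBlind
⟨θ₁₅ᶜᶜᴹᵂᶻ, ZrOfRecord₁₃ θ₁₅ᶜᶜᴹᵂᶻ⟩` for EVERY pair of letters `(Efl, logz)` — Part 8's (`N24ItemsStage13AtThm1CCMWSepCoPH` §0) and Part 9ʷ's (`…OfStepRSignFreeAllTorusSepCoPH` §0) door lemmas
under the one-token map `theta13OfThm1CCMW … ↦ theta13OfThm1CCMWZ … Efl logz`, every proof ONE application of a θ-GENERIC tree theorem at DEF-1's rows: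
* §0 `N24_rOpLeaf_VOfRecord₁₃CoPH_theta13OfThm1CCMWZ`, ★ `N24_laws₁₃CoPH_theta13OfThm1CCMWZ` — N13's (R₁₃) at `(⟨⟨θ₁₅ᶜᶜᴹᵂᶻ, Zr⟩, Zh, Phih⟩ : Stage13HParams F N)` from the window + six signs
  (dag-n11-e's θ-GENERIC `B16RLeafRecord13LiveCoPH.rOpLeaf_VOfRecord₁₃CoPH_liveRepin₁₃_of_hasResiduals` at `theta13OfNumericsZ …` with DEF-1's `hasResidualsOfRecord_theta13OfNumericsZ` ∕
  `admissible_theta13OfNumericsZ`; numerals `κ = 2·10⁴`, `E₀ = B₀ = 1` by `rfl`).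
* §1 ★ `N24_provisos₁₃SepCoP_theta13OfThm1CCMWZ_of_thm1GaugeR_of_hcomp_allTorus` (v1.5 level, general `N`): K0a's θ-GENERIC `Stage13Params.provisos₁₃SepCoP_liveRepin₁₃_of_bgSepCoP` at
  `theta13OfNumericsZ …`, fed by dag-n21-c's ROW-P11 lemma `bgSepCoPAt_theta13OfThm1CCMW_of_thm1GaugeR_of_hcomp_allTorus` — whose statement reads ONLY E-FREE letters (`γ`, `ν`, `τ9`, `s2`,
  `Rz`, `gOfRecord₁₃`, `settingOfRecord₁₃`, `suppOfRecord₁₃P`, `UbgOfRecord₁₃CoP`, `PartCompat₁₃`; this seat's kernel census, evidence #40 on 27364), hence IS the row at the z-witness by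
  definitional unfolding (`theta13OfThm1CCMW = theta13OfThm1CCMWZ … 0 0` and the letters do not read `Efl ∕ logz`); ★ `…_of_gauge9TopStepR_of_betaBoxSignFree_allTorus` (the K0-side road of
  record: (8) + dag-n07-e's R (9)-step + the SIGN-FREE windowed β-box — β₁₃ is E-free, so the box at `θ₁₅ᶜᶜᴹᵂᶻ` IS the box at `θ₁₅ᶜᶜᴹᵂ`); §1b the v1.7 DOORS
  ★★ `N24_provisos₁₃SepCoPH_door_theta13OfThm1CCMWZ_of_thm1GaugeR_of_hcomp_allTorus` ∕ ★★ `…_of_gauge9TopStepR_of_betaBoxSignFree_allTorus` (`.ofCured.ofHistoryBlind`).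
* §2 the other three rows BY NAME at the door: `N24_admissible_door_theta13OfThm1CCMWZ` (DEF-1's `admissible_theta13OfThm1CCMWZ_of_le_half` through `admissible_ofHistoryBlind_iff`),
  `N24_unity_slots_door_theta13OfThm1CCMWZ` (`Stage13RParams.ZrUnity.ofHistoryBlind ∘ finsum_ζ0_ZrOfRecord₁₃` ∧ DEF-1's hypothesis-free `slotsNondegenerate₁₃_theta13OfThm1CCMWZ`),
  `N24_laws_door_theta13OfThm1CCMWZ` (§0 at the door's slots).
HONEST FRAMING: kernel bookkeeping BY NAME; nothing of Bałaban's asserted; the provisos rows are CONDITIONAL on their displayed K0-side hypotheses ((8), the (9)-step ∕ gauge sentence, the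
clauses or the β-box); no value of `E_k` ∕ `log z_k` is pinned (the letters stay OPEN); K0⁷ ∕ K1⁹ NOT closed; FLAG №9 NOT closed by this file (№218 (4) needs the re-keyed CLOSER + a referee
PASS); N24 COMPOSITE — no discharge, no count moved (typed 28∕28 · discharged 5∕27 · A 5∕28); one finite 𝕋⁴ programme at fixed ε; NOT continuum ∕ ℝ⁴ ∕ OS ∕ mass gap ∕ Clay.
-/

noncomputable section

open scoped Matrix.Norms.L2Operator

namespace Literature.MathematicalPhysics.QuantumFieldTheory.Balaban1983to89.Node00

open DagBinding T4Continuum T4DatumAssembly FlowStepRuns AveragingRT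
open FlowStep (BetaLowerH BetaUpperH)
open B16RLeafRecord13LiveCoPH (rOpLeaf_VOfRecord₁₃CoPH_liveRepin₁₃_of_hasResiduals)

variable {F : T4Family} {N : ℕ} [NeZero N]

/-! ## §0. N13's (R₁₃) 𝐑-leaf at the z-witness — dag-n11-e's θ-generic re-pin leaf at DEF-1's `theta13OfNumericsZ` -/

section RLeaf

variable {j : ℕ} {γ ε₀ ε₂₉ B₃ B₃' a₀ a₁ : ℝ} {Efl logz : B12.RunParams → ℕ → ℝ} (Zr : (q : B12.RunParams) → TkResidualW F N (FluctV N) q.K)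
  (Zh : (q : B12.RunParams) → ℕ → (ℕ → Set (Site (F.P q.K) 0)) → (ℕ → Set (Site (F.P q.K) 0)) → TkResidualW F N (FluctV N) q.K)
  (Phih : (q : B12.RunParams) → ℕ → (ℕ → Set (Site (F.P q.K) 0)) → (ℕ → Set (Site (F.P q.K) 0)) → (ℕ → Plaq (F.P q.K) 0 → ℝ)) (p : B12.RunParams)

/-- **★ N13's CoPH 𝐑-leaf at the z-witness `θ₁₅ᶜᶜᴹᵂᶻ(j; γ; Efl, logz)`** with free residual slots, from the window `0 < γ ≤ ½` and the six admissibility signs — WHATEVER THE LETTERS: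
dag-n11-e's θ-GENERIC re-pin leaf `rOpLeaf_VOfRecord₁₃CoPH_liveRepin₁₃_of_hasResiduals` at DEF-1's `theta13OfNumericsZ` (`θ₁₅ᶜᶜᴹᵂᶻ` IS its live re-pin, `rfl`), fed by DEF-1's
`hasResidualsOfRecord_theta13OfNumericsZ` ∕ `admissible_theta13OfNumericsZ`, dag-n21-c's `stage12NumericsOfThm1CCMW_pos_of_le_half` and the family's numerals `κ = 2·10⁴`, `E₀ = B₀ = 1` (`rfl`).
Part 8 §0 is the `(0,0)` instance. [cite: Balaban1988Convergent, p.244, (3.16) p.268; Balaban1989LargeFieldI, (0.3)–(0.4) p.176, p.177 (i)–(ii); Balaban1989LargeFieldII, Thm 1 p.355 (not exercised); Balaban1987RG1, Thm 1 p.255, §1 p.264 (window)] -/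
theorem N24_rOpLeaf_VOfRecord₁₃CoPH_theta13OfThm1CCMWZ (hγ₀ : 0 < γ) (hγh : γ ≤ 1 / 2) (hε : 0 < ε₀) (hε' : 0 < ε₂₉) (hB : 0 ≤ B₃) (hB' : 0 ≤ B₃') (ha₀ : 0 < a₀) (ha₁ : 0 < a₁) :
    ROpLeaf (VOfRecord₁₃CoPH F N (⟨⟨theta13OfThm1CCMWZ F N j γ ε₀ ε₂₉ B₃ B₃' a₀ a₁ Efl logz, Zr⟩, Zh, Phih⟩ : Stage13HParams F N) p) := by
  have hκ : (theta13OfNumericsZ F N (stage12NumericsOfThm1CCMW F.L j γ ε₀ B₃ B₃' a₀ a₁) ε₂₉ (zeta316OfRecord F N (stage12NumericsOfThm1CCMW F.L j γ ε₀ B₃ B₃' a₀ a₁).ν (stage12NumericsOfThm1CCMW F.L j γ ε₀ B₃ B₃' a₀ a₁).τ9.M (stage12NumericsOfThm1CCMW F.L j γ ε₀ B₃ B₃' a₀ a₁).A₁) (RzOfRecord F N) (ZtOfRecord F N) Efl logz).s2.lf.κ = 20000 := rfl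
  have hE : (theta13OfNumericsZ F N (stage12NumericsOfThm1CCMW F.L j γ ε₀ B₃ B₃' a₀ a₁) ε₂₉ (zeta316OfRecord F N (stage12NumericsOfThm1CCMW F.L j γ ε₀ B₃ B₃' a₀ a₁).ν (stage12NumericsOfThm1CCMW F.L j γ ε₀ B₃ B₃' a₀ a₁).τ9.M (stage12NumericsOfThm1CCMW F.L j γ ε₀ B₃ B₃' a₀ a₁).A₁) (RzOfRecord F N) (ZtOfRecord F N) Efl logz).s2.lf.E₀ = 1 := rfl
  have hB0 : (theta13OfNumericsZ F N (stage12NumericsOfThm1CCMW F.L j γ ε₀ B₃ B₃' a₀ a₁) ε₂₉ (zeta316OfRecord F N (stage12NumericsOfThm1CCMW F.L j γ ε₀ B₃ B₃' a₀ a₁).ν (stage12NumericsOfThm1CCMW F.L j γ ε₀ B₃ B₃' a₀ a₁).τ9.M (stage12NumericsOfThm1CCMW F.L j γ ε₀ B₃ B₃' a₀ a₁).A₁) (RzOfRecord F N) (ZtOfRecord F N) Efl logz).s2.lf.B₀ = 1 := rfl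
  exact rOpLeaf_VOfRecord₁₃CoPH_liveRepin₁₃_of_hasResiduals F N (theta13OfNumericsZ F N (stage12NumericsOfThm1CCMW F.L j γ ε₀ B₃ B₃' a₀ a₁) ε₂₉ (zeta316OfRecord F N (stage12NumericsOfThm1CCMW F.L j γ ε₀ B₃ B₃' a₀ a₁).ν (stage12NumericsOfThm1CCMW F.L j γ ε₀ B₃ B₃' a₀ a₁).τ9.M (stage12NumericsOfThm1CCMW F.L j γ ε₀ B₃ B₃' a₀ a₁).A₁) (RzOfRecord F N) (ZtOfRecord F N) Efl logz) Zr Zh Phih p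
    (hasResidualsOfRecord_theta13OfNumericsZ F N _ ε₂₉ Efl logz)
    (admissible_theta13OfNumericsZ F N _ _ _ Efl logz (stage12NumericsOfThm1CCMW_pos_of_le_half F.hL.2.le hγ₀ hγh hε hB hB' ha₀ ha₁) hε')
    (by rw [hκ]; norm_num) (by rw [hE]; norm_num) (by rw [hB0]; norm_num)

/-- **N13's (R₁₃) slot in law form at the z-witness** (free residual slots): `∀ k < K, TLaw₁₃CoPH k → SLaw₁₃CoPH (k+1)` from the window and the six signs — §0's leaf through
def-T's `rOpLeaf_VOfRecord₁₃CoPH_iff`. [cite: Balaban1988Convergent, p.244 (bookkeeping); Balaban1989LargeFieldII, Thm 1 p.355 (not exercised)] -/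
theorem N24_laws₁₃CoPH_theta13OfThm1CCMWZ (hγ₀ : 0 < γ) (hγh : γ ≤ 1 / 2) (hε : 0 < ε₀) (hε' : 0 < ε₂₉) (hB : 0 ≤ B₃) (hB' : 0 ≤ B₃') (ha₀ : 0 < a₀) (ha₁ : 0 < a₁) :
    ∀ k, k < p.K →
      TLaw₁₃CoPH F N (⟨⟨theta13OfThm1CCMWZ F N j γ ε₀ ε₂₉ B₃ B₃' a₀ a₁ Efl logz, Zr⟩, Zh, Phih⟩ : Stage13HParams F N) p k →
        SLaw₁₃CoPH F N (⟨⟨theta13OfThm1CCMWZ F N j γ ε₀ ε₂₉ B₃ B₃' a₀ a₁ Efl logz, Zr⟩, Zh, Phih⟩ : Stage13HParams F N) p (k + 1) :=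
  (rOpLeaf_VOfRecord₁₃CoPH_iff F N _ p).mp (N24_rOpLeaf_VOfRecord₁₃CoPH_theta13OfThm1CCMWZ Zr Zh Phih p hγ₀ hγh hε hε' hB hB' ha₀ ha₁)

end RLeaf

/-! ## §1. `Provisos₁₃SepCoP` ∕ the v1.7 door provisos at the z-witness — K0a's θ-generic re-pin socket at `theta13OfNumericsZ`, fed by dag-n21-c's E-free row P11 -/

section Provisos

variable {j c : ℕ} {γ ε₀ ε₂₉ B₃ B₃' a₀ a₁ : ℝ} {Efl logz : B12.RunParams → ℕ → ℝ}

/-- **★ THE v1.5 PROVISOS AT THE z-WITNESS, POINTED, FROM THE WINDOW, (8), THE (9)-LINE-1 GAUGE SENTENCE AND (hcomp) ∧ (hcompRev)** (general `N`, collar exponent `j`, floor `c`,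
window `0 < γ ≤ ½`, ANY letters `Efl logz`): K0a's θ-GENERIC `Stage13Params.provisos₁₃SepCoP_liveRepin₁₃_of_bgSepCoP` at DEF-1's `theta13OfNumericsZ` (`hM := ⟨j, rfl⟩`, `hM₁ := dvd_refl`),
its row-P11 socket fed by dag-n21-c's `bgSepCoPAt_theta13OfThm1CCMW_of_thm1GaugeR_of_hcomp_allTorus` — a statement over E-FREE letters only, so it IS the row at `θ₁₅ᶜᶜᴹᵂᶻ` by unfolding
(`theta13OfThm1CCMW = theta13OfThm1CCMWZ … 0 0`, `rfl`; none of `γ, ν, τ9, s2, Rz, gOfRecord₁₃, settingOfRecord₁₃, suppOfRecord₁₃P, UbgOfRecord₁₃CoP, PartCompat₁₃` reads `Efl ∕ logz`).  The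
compatibility clauses are displayed in the z-witness's letters (the same terms).  CONDITIONAL; nothing of Bałaban asserted; K0⁷ NOT closed here.
[cite: Balaban1985Variational, (6)–(7) p.278, Thm 1 (8)–(9) p.279, (144)–(152) pp.300–301; Balaban1985RegularSpaces, (1.3)–(1.9) p.77; Balaban1988Convergent, Thm 1 p.262, (2.4)–(2.8) pp.255–256, (2.12)–(2.13) p.256, (2.18) p.257, (2.25)–(2.28) pp.258–259, (2.34)–(2.41) p.261; Balaban1987RG1, Thm 1 p.255, (1.11)–(1.12) p.262; Balaban1989LargeFieldII, (1.4) p.357] -/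
theorem N24_provisos₁₃SepCoP_theta13OfThm1CCMWZ_of_thm1GaugeR_of_hcomp_allTorus
    (hγ₀ : 0 < γ) (hγh : γ ≤ 1 / 2) (hε : 0 < ε₀) (hε' : 0 < ε₂₉) (hB : 0 ≤ B₃) (hB' : 0 ≤ B₃') (ha₀ : 0 < a₀) (ha₁ : 0 < a₁)
    (h15 : VariationalThm1RegSepCoP7MGB F N (floorGuard F c) (lamDatum F) (dataSmall7PTopOf F N) B₃ a₀ a₁) (hc : c ≤ F.L ^ j) (h15G : VariationalThm1GaugeRegSepCoP7MGB F N (F.L ^ j) (floorGuard F c) (lamDatum F) (dataSmall7PTopOf F N) B₃ B₃' a₀ a₁)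
    (hcomp : ∀ (p : B12.RunParams) (n : ℕ), n ≤ p.K → Step.InInterval (theta13OfThm1CCMWZ F N j γ ε₀ ε₂₉ B₃ B₃' a₀ a₁ Efl logz).γ n (gOfRecord₁₃ F N (theta13OfThm1CCMWZ F N j γ ε₀ ε₂₉ B₃ B₃' a₀ a₁ Efl logz) p) → ∀ m, m < n →
      (theta13OfThm1CCMWZ F N j γ ε₀ ε₂₉ B₃ B₃' a₀ a₁ Efl logz).s2.cR * epsOfRecord (theta13OfThm1CCMWZ F N j γ ε₀ ε₂₉ B₃ B₃' a₀ a₁ Efl logz).ν (gOfRecord₁₃ F N (theta13OfThm1CCMWZ F N j γ ε₀ ε₂₉ B₃ B₃' a₀ a₁ Efl logz) p) m ≤ 2 * ((theta13OfThm1CCMWZ F N j γ ε₀ ε₂₉ B₃ B₃' a₀ a₁ Efl logz).s2.cR * epsOfRecord (theta13OfThm1CCMWZ F N j γ ε₀ ε₂₉ B₃ B₃' a₀ a₁ Efl logz).ν (gOfRecord₁₃ F N (theta13OfThm1CCMWZ F N j γ ε₀ ε₂₉ B₃ B₃' a₀ a₁ Efl logz) p) (m + 1)))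
    (hcompRev : ∀ (p : B12.RunParams) (n : ℕ), n ≤ p.K → Step.InInterval (theta13OfThm1CCMWZ F N j γ ε₀ ε₂₉ B₃ B₃' a₀ a₁ Efl logz).γ n (gOfRecord₁₃ F N (theta13OfThm1CCMWZ F N j γ ε₀ ε₂₉ B₃ B₃' a₀ a₁ Efl logz) p) → ∀ m, m < n →
      (theta13OfThm1CCMWZ F N j γ ε₀ ε₂₉ B₃ B₃' a₀ a₁ Efl logz).s2.cR * epsOfRecord (theta13OfThm1CCMWZ F N j γ ε₀ ε₂₉ B₃ B₃' a₀ a₁ Efl logz).ν (gOfRecord₁₃ F N (theta13OfThm1CCMWZ F N j γ ε₀ ε₂₉ B₃ B₃' a₀ a₁ Efl logz) p) (m + 1) ≤ 2 * ((theta13OfThm1CCMWZ F N j γ ε₀ ε₂₉ B₃ B₃' a₀ a₁ Efl logz).s2.cR * epsOfRecord (theta13OfThm1CCMWZ F N j γ ε₀ ε₂₉ B₃ B₃' a₀ a₁ Efl logz).ν (gOfRecord₁₃ F N (theta13OfThm1CCMWZ F N j γ ε₀ ε₂₉ B₃ B₃' a₀ a₁ Efl logz) p) m)) :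
    (theta13OfThm1CCMWZ F N j γ ε₀ ε₂₉ B₃ B₃' a₀ a₁ Efl logz).Provisos₁₃SepCoP F N :=
  Stage13Params.provisos₁₃SepCoP_liveRepin₁₃_of_bgSepCoP (F := F) (N := N)
    (θ := theta13OfNumericsZ F N (stage12NumericsOfThm1CCMW F.L j γ ε₀ B₃ B₃' a₀ a₁) ε₂₉ (zeta316OfRecord F N (stage12NumericsOfThm1CCMW F.L j γ ε₀ B₃ B₃' a₀ a₁).ν (stage12NumericsOfThm1CCMW F.L j γ ε₀ B₃ B₃' a₀ a₁).τ9.M (stage12NumericsOfThm1CCMW F.L j γ ε₀ B₃ B₃' a₀ a₁).A₁) (RzOfRecord F N) (ZtOfRecord F N) Efl logz)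
    (hasResidualsOfRecord_theta13OfNumericsZ F N _ ε₂₉ Efl logz) ⟨j, rfl⟩ (dvd_refl _)
    (bgSepCoPAt_theta13OfThm1CCMW_of_thm1GaugeR_of_hcomp_allTorus hγ₀ hγh hε hε' hB hB' ha₀ ha₁ h15 hc h15G hcomp hcompRev)

/-- **★ THE v1.5 PROVISOS AT THE z-WITNESS, KEYED ON dag-n07-e's R (9)-STEP FACT AND THE SIGN-FREE WINDOWED β-BOX WITH LETTERS** (`bₗ`, `β'`, `−bₗ·γ² ≤ 3`, `β'·γ² ≤ ¾`; NO sign):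
`betaOfRecord₁₃` is E-free, so the box at `θ₁₅ᶜᶜᴹᵂᶻ` IS the box at `θ₁₅ᶜᶜᴹᵂ` and dag-n21-c's FILE Dʷ `hcompBoth_theta13OfThm1CCMW_of_betaBoxSignFree` gives (hcomp) ∧ (hcompRev); the gauge
sentence by B′ §4 `variationalThm1GaugeRegSepCoP7MGB_of_gauge9TopStepGB`; then the previous theorem.  = Part 9ʷ §0c₀ at the z-witness.  CONDITIONAL; nothing of Bałaban asserted.
[cite: Balaban1985Variational, Thm 1 (8)–(9) p.279, (144)–(152) pp.300–301, Prop. 8 p.304; Balaban1988Convergent, Thm 1 p.262, (2.6)–(2.8) pp.255–256; Balaban1987RG1, Thm 1 p.255, (0.20) p.256, (1.20)–(1.22) p.264, §1 p.264] -/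
theorem N24_provisos₁₃SepCoP_theta13OfThm1CCMWZ_of_gauge9TopStepR_of_betaBoxSignFree_allTorus
    (hγ₀ : 0 < γ) (hγh : γ ≤ 1 / 2) (hε : 0 < ε₀) (hε' : 0 < ε₂₉) (hB : 0 ≤ B₃) (hB' : 0 ≤ B₃') (ha₀ : 0 < a₀) (ha₁ : 0 < a₁)
    (h15 : VariationalThm1RegSepCoP7MGB F N (floorGuard F c) (lamDatum F) (dataSmall7PTopOf F N) B₃ a₀ a₁) (hc : c ≤ F.L ^ j)
    (h9 : Gauge9RegSepTopStepGB F N (fun ν K Ω => suppDomOfRecord F ν K Ω) (F.L ^ j) (floorGuard F c) (lamDatum F) (dataSmall7PTopOf F N) B₃ B₃' a₀ a₁)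
    {bl β' : ℝ} (hbox : BetaLowerH bl γ (betaOfRecord₁₃ F N (theta13OfThm1CCMWZ F N j γ ε₀ ε₂₉ B₃ B₃' a₀ a₁ Efl logz)))
    (hbox' : BetaUpperH β' γ (betaOfRecord₁₃ F N (theta13OfThm1CCMWZ F N j γ ε₀ ε₂₉ B₃ B₃' a₀ a₁ Efl logz))) (hl : -bl * γ ^ 2 ≤ 3) (hβ' : β' * γ ^ 2 ≤ 3 / 4) :
    (theta13OfThm1CCMWZ F N j γ ε₀ ε₂₉ B₃ B₃' a₀ a₁ Efl logz).Provisos₁₃SepCoP F N :=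
  have H := hcompBoth_theta13OfThm1CCMW_of_betaBoxSignFree (F := F) (N := N) (j := j) (ε₀ := ε₀) (ε₂₉ := ε₂₉) hγh hB hB' ha₀.le ha₁.le hbox hbox' hl hβ'
  N24_provisos₁₃SepCoP_theta13OfThm1CCMWZ_of_thm1GaugeR_of_hcomp_allTorus hγ₀ hγh hε hε' hB hB' ha₀ ha₁ h15 hc (variationalThm1GaugeRegSepCoP7MGB_of_gauge9TopStepGB h9) H.1 H.2

/-- **★★ THE v1.7 DOOR PROVISOS AT THE z-WITNESS from the window, (8), the (9)-line-1 gauge sentence and (hcomp) ∧ (hcompRev)** — §1's first theorem pushed through K0a's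
`Stage13Params.Provisos₁₃SepCoP.ofCured` and def-T's `Stage13RParams.Provisos₁₃SepCoPR.ofHistoryBlind`.  CONDITIONAL; nothing of Bałaban asserted.
[cite: Balaban1985Variational, Thm 1 (8)–(9) p.279, (152) p.301; Balaban1988Convergent, Thm 1 p.262, (2.21) p.258, (3.16)–(3.23) pp.268–270; Balaban1989LargeFieldI, (0.2)–(0.4) p.176; Balaban1989LargeFieldII, (1.4) p.357] -/
theorem N24_provisos₁₃SepCoPH_door_theta13OfThm1CCMWZ_of_thm1GaugeR_of_hcomp_allTorus
    (hγ₀ : 0 < γ) (hγh : γ ≤ 1 / 2) (hε : 0 < ε₀) (hε' : 0 < ε₂₉) (hB : 0 ≤ B₃) (hB' : 0 ≤ B₃') (ha₀ : 0 < a₀) (ha₁ : 0 < a₁)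
    (h15 : VariationalThm1RegSepCoP7MGB F N (floorGuard F c) (lamDatum F) (dataSmall7PTopOf F N) B₃ a₀ a₁) (hc : c ≤ F.L ^ j) (h15G : VariationalThm1GaugeRegSepCoP7MGB F N (F.L ^ j) (floorGuard F c) (lamDatum F) (dataSmall7PTopOf F N) B₃ B₃' a₀ a₁)
    (hcomp : ∀ (p : B12.RunParams) (n : ℕ), n ≤ p.K → Step.InInterval (theta13OfThm1CCMWZ F N j γ ε₀ ε₂₉ B₃ B₃' a₀ a₁ Efl logz).γ n (gOfRecord₁₃ F N (theta13OfThm1CCMWZ F N j γ ε₀ ε₂₉ B₃ B₃' a₀ a₁ Efl logz) p) → ∀ m, m < n →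
      (theta13OfThm1CCMWZ F N j γ ε₀ ε₂₉ B₃ B₃' a₀ a₁ Efl logz).s2.cR * epsOfRecord (theta13OfThm1CCMWZ F N j γ ε₀ ε₂₉ B₃ B₃' a₀ a₁ Efl logz).ν (gOfRecord₁₃ F N (theta13OfThm1CCMWZ F N j γ ε₀ ε₂₉ B₃ B₃' a₀ a₁ Efl logz) p) m ≤ 2 * ((theta13OfThm1CCMWZ F N j γ ε₀ ε₂₉ B₃ B₃' a₀ a₁ Efl logz).s2.cR * epsOfRecord (theta13OfThm1CCMWZ F N j γ ε₀ ε₂₉ B₃ B₃' a₀ a₁ Efl logz).ν (gOfRecord₁₃ F N (theta13OfThm1CCMWZ F N j γ ε₀ ε₂₉ B₃ B₃' a₀ a₁ Efl logz) p) (m + 1)))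
    (hcompRev : ∀ (p : B12.RunParams) (n : ℕ), n ≤ p.K → Step.InInterval (theta13OfThm1CCMWZ F N j γ ε₀ ε₂₉ B₃ B₃' a₀ a₁ Efl logz).γ n (gOfRecord₁₃ F N (theta13OfThm1CCMWZ F N j γ ε₀ ε₂₉ B₃ B₃' a₀ a₁ Efl logz) p) → ∀ m, m < n →
      (theta13OfThm1CCMWZ F N j γ ε₀ ε₂₉ B₃ B₃' a₀ a₁ Efl logz).s2.cR * epsOfRecord (theta13OfThm1CCMWZ F N j γ ε₀ ε₂₉ B₃ B₃' a₀ a₁ Efl logz).ν (gOfRecord₁₃ F N (theta13OfThm1CCMWZ F N j γ ε₀ ε₂₉ B₃ B₃' a₀ a₁ Efl logz) p) (m + 1) ≤ 2 * ((theta13OfThm1CCMWZ F N j γ ε₀ ε₂₉ B₃ B₃' a₀ a₁ Efl logz).s2.cR * epsOfRecord (theta13OfThm1CCMWZ F N j γ ε₀ ε₂₉ B₃ B₃' a₀ a₁ Efl logz).ν (gOfRecord₁₃ F N (theta13OfThm1CCMWZ F N j γ ε₀ ε₂₉ B₃ B₃' a₀ a₁ Efl logz) p) m)) :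
    (Stage13HParams.ofHistoryBlind F N ⟨theta13OfThm1CCMWZ F N j γ ε₀ ε₂₉ B₃ B₃' a₀ a₁ Efl logz, ZrOfRecord₁₃ F N (theta13OfThm1CCMWZ F N j γ ε₀ ε₂₉ B₃ B₃' a₀ a₁ Efl logz)⟩).Provisos₁₃SepCoPH F N :=
  (N24_provisos₁₃SepCoP_theta13OfThm1CCMWZ_of_thm1GaugeR_of_hcomp_allTorus hγ₀ hγh hε hε' hB hB' ha₀ ha₁ h15 hc h15G hcomp hcompRev).ofCured.ofHistoryBlind

/-- **★★ THE v1.7 DOOR PROVISOS AT THE z-WITNESS, KEYED ON THE R (9)-STEP FACT AND THE SIGN-FREE WINDOWED β-BOX WITH LETTERS** (NO sign) — the road of record for the K1 closers'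
`hP` (Part 38b ∕ p639124 §3's `hP F i`); = Part 9ʷ §0c at the z-witness.  CONDITIONAL; nothing of Bałaban asserted; K0⁷ NOT closed here.
[cite: Balaban1985Variational, Thm 1 (8)–(9) p.279, Prop. 8 p.304; Balaban1988Convergent, Thm 1 p.262, (2.6)–(2.8) pp.255–256, (2.21) p.258, (3.16)–(3.23) pp.268–270; Balaban1987RG1, Thm 1 p.255, (0.20) p.256, (1.20)–(1.22) p.264, §1 p.264; Balaban1989LargeFieldI, (0.2)–(0.4) p.176] -/
theorem N24_provisos₁₃SepCoPH_door_theta13OfThm1CCMWZ_of_gauge9TopStepR_of_betaBoxSignFree_allTorus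
    (hγ₀ : 0 < γ) (hγh : γ ≤ 1 / 2) (hε : 0 < ε₀) (hε' : 0 < ε₂₉) (hB : 0 ≤ B₃) (hB' : 0 ≤ B₃') (ha₀ : 0 < a₀) (ha₁ : 0 < a₁)
    (h15 : VariationalThm1RegSepCoP7MGB F N (floorGuard F c) (lamDatum F) (dataSmall7PTopOf F N) B₃ a₀ a₁) (hc : c ≤ F.L ^ j)
    (h9 : Gauge9RegSepTopStepGB F N (fun ν K Ω => suppDomOfRecord F ν K Ω) (F.L ^ j) (floorGuard F c) (lamDatum F) (dataSmall7PTopOf F N) B₃ B₃' a₀ a₁)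
    {bl β' : ℝ} (hbox : BetaLowerH bl γ (betaOfRecord₁₃ F N (theta13OfThm1CCMWZ F N j γ ε₀ ε₂₉ B₃ B₃' a₀ a₁ Efl logz)))
    (hbox' : BetaUpperH β' γ (betaOfRecord₁₃ F N (theta13OfThm1CCMWZ F N j γ ε₀ ε₂₉ B₃ B₃' a₀ a₁ Efl logz))) (hl : -bl * γ ^ 2 ≤ 3) (hβ' : β' * γ ^ 2 ≤ 3 / 4) :
    (Stage13HParams.ofHistoryBlind F N ⟨theta13OfThm1CCMWZ F N j γ ε₀ ε₂₉ B₃ B₃' a₀ a₁ Efl logz, ZrOfRecord₁₃ F N (theta13OfThm1CCMWZ F N j γ ε₀ ε₂₉ B₃ B₃' a₀ a₁ Efl logz)⟩).Provisos₁₃SepCoPH F N :=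
  (N24_provisos₁₃SepCoP_theta13OfThm1CCMWZ_of_gauge9TopStepR_of_betaBoxSignFree_allTorus hγ₀ hγh hε hε' hB hB' ha₀ ha₁ h15 hc h9 hbox hbox' hl hβ').ofCured.ofHistoryBlind

end Provisos

/-! ## §2. The other three door rows at `ofHistoryBlind ⟨θ₁₅ᶜᶜᴹᵂᶻ, ZrOfRecord₁₃ θ₁₅ᶜᶜᴹᵂᶻ⟩` BY NAME: admissibility, unity ∧ slot non-degeneracy, the (R₁₃) law chain -/

section DoorRows

variable {j : ℕ} {γ ε₀ ε₂₉ B₃ B₃' a₀ a₁ : ℝ} (Efl logz : B12.RunParams → ℕ → ℝ)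

/-- **Row G at the door**: `Admissible` from `0 < γ ≤ ½` and the six signs, WHATEVER THE LETTERS (DEF-1's `admissible_theta13OfThm1CCMWZ_of_le_half`; the `ofHistoryBlind` wrap is
admissibility-neutral, `Stage13HParams.admissible_ofHistoryBlind_iff`). [cite: Balaban1987RG1, Thm 1 p.259, (0.21) p.256, (2.9) p.266; Balaban1988Convergent, (2.10) p.256 (bookkeeping)] -/
theorem N24_admissible_door_theta13OfThm1CCMWZ (hγ₀ : 0 < γ) (hγh : γ ≤ 1 / 2) (hε : 0 < ε₀) (hε' : 0 < ε₂₉) (hB : 0 ≤ B₃) (hB' : 0 ≤ B₃') (ha₀ : 0 < a₀) (ha₁ : 0 < a₁) :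
    (Stage13HParams.ofHistoryBlind F N ⟨theta13OfThm1CCMWZ F N j γ ε₀ ε₂₉ B₃ B₃' a₀ a₁ Efl logz, ZrOfRecord₁₃ F N (theta13OfThm1CCMWZ F N j γ ε₀ ε₂₉ B₃ B₃' a₀ a₁ Efl logz)⟩).Admissible F N :=
  Stage13HParams.admissible_ofHistoryBlind_iff.2 (admissible_theta13OfThm1CCMWZ_of_le_half F N Efl logz hγ₀ hγh hε hε' hB hB' ha₀ ha₁)

/-- **Rows `ZhUnity` ∧ P12 at the door**, WHATEVER THE LETTERS: print's partition of unity of the CURED residual (`Stage13RParams.ZrUnity.ofHistoryBlind` over K0a's `finsum_ζ0_ZrOfRecord₁₃`)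
and DEF-1's hypothesis-free `slotsNondegenerate₁₃_theta13OfThm1CCMWZ` (the wrap does not touch the slots). [cite: Balaban1988Convergent, (3.16)–(3.20) pp.268–269, (3.22) p.269; Balaban1989LargeFieldI, (0.3)–(0.4) p.176 (bookkeeping)] -/
theorem N24_unity_slots_door_theta13OfThm1CCMWZ :
    (Stage13HParams.ofHistoryBlind F N ⟨theta13OfThm1CCMWZ F N j γ ε₀ ε₂₉ B₃ B₃' a₀ a₁ Efl logz, ZrOfRecord₁₃ F N (theta13OfThm1CCMWZ F N j γ ε₀ ε₂₉ B₃ B₃' a₀ a₁ Efl logz)⟩).ZhUnity F N ∧ (Stage13HParams.ofHistoryBlind F N ⟨theta13OfThm1CCMWZ F N j γ ε₀ ε₂₉ B₃ B₃' a₀ a₁ Efl logz, ZrOfRecord₁₃ F N (theta13OfThm1CCMWZ F N j γ ε₀ ε₂₉ B₃ B₃' a₀ a₁ Efl logz)⟩).SlotsNondegenerate₁₃ F N :=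
  ⟨Stage13RParams.ZrUnity.ofHistoryBlind (θ := ⟨theta13OfThm1CCMWZ F N j γ ε₀ ε₂₉ B₃ B₃' a₀ a₁ Efl logz, ZrOfRecord₁₃ F N (theta13OfThm1CCMWZ F N j γ ε₀ ε₂₉ B₃ B₃' a₀ a₁ Efl logz)⟩)
      (fun p i ω => finsum_ζ0_ZrOfRecord₁₃ (θ := theta13OfThm1CCMWZ F N j γ ε₀ ε₂₉ B₃ B₃' a₀ a₁ Efl logz) (p := p) i ω),
    slotsNondegenerate₁₃_theta13OfThm1CCMWZ F N j γ ε₀ ε₂₉ B₃ B₃' a₀ a₁ Efl logz⟩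

/-- **N13's (R₁₃) law chain at the door**, WHATEVER THE LETTERS — §0 at the door's residual slots (`Zr := ZrOfRecord₁₃`, `Zh := fun p _ _ _ => ZrOfRecord₁₃ … p`, `Phih := fun p _ _ _ => (Rz p.K).phi`,
the `ofHistoryBlind` fields). [cite: Balaban1988Convergent, p.244 (bookkeeping); Balaban1989LargeFieldII, Thm 1 p.355 (not exercised)] -/
theorem N24_laws_door_theta13OfThm1CCMWZ (hγ₀ : 0 < γ) (hγh : γ ≤ 1 / 2) (hε : 0 < ε₀) (hε' : 0 < ε₂₉) (hB : 0 ≤ B₃) (hB' : 0 ≤ B₃') (ha₀ : 0 < a₀) (ha₁ : 0 < a₁) :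
    ∀ (P : B12.RunParams) (k : ℕ), k < P.K → TLaw₁₃CoPH F N (Stage13HParams.ofHistoryBlind F N ⟨theta13OfThm1CCMWZ F N j γ ε₀ ε₂₉ B₃ B₃' a₀ a₁ Efl logz, ZrOfRecord₁₃ F N (theta13OfThm1CCMWZ F N j γ ε₀ ε₂₉ B₃ B₃' a₀ a₁ Efl logz)⟩) P k → SLaw₁₃CoPH F N (Stage13HParams.ofHistoryBlind F N ⟨theta13OfThm1CCMWZ F N j γ ε₀ ε₂₉ B₃ B₃' a₀ a₁ Efl logz, ZrOfRecord₁₃ F N (theta13OfThm1CCMWZ F N j γ ε₀ ε₂₉ B₃ B₃' a₀ a₁ Efl logz)⟩) P (k + 1) :=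
  fun P => N24_laws₁₃CoPH_theta13OfThm1CCMWZ (ZrOfRecord₁₃ F N (theta13OfThm1CCMWZ F N j γ ε₀ ε₂₉ B₃ B₃' a₀ a₁ Efl logz)) (fun p _ _ _ => ZrOfRecord₁₃ F N (theta13OfThm1CCMWZ F N j γ ε₀ ε₂₉ B₃ B₃' a₀ a₁ Efl logz) p)
    (fun p _ _ _ => ((theta13OfThm1CCMWZ F N j γ ε₀ ε₂₉ B₃ B₃' a₀ a₁ Efl logz).Rz p.K).phi) P hγ₀ hγh hε hε' hB hB' ha₀ ha₁

end DoorRows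

end Literature.MathematicalPhysics.QuantumFieldTheory.Balaban1983to89.Node00

end
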